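import Mathlib
import HarnessLib
import HarnessLib.Audit
import Summits.AtomisticToContinuum.Statement
import Literature.MathematicalPhysics.QuantumManyBody.PeriodicBoseGasJastrow

/-!
Route: BECJastrowRigidity

CLOSED (retired) 2026-08-15T13:39:03Z by operator:999:1257524 — reason: not-a-thesis: assembly does not conclude the sub-problem Statement — note: D-0027 §2.1 audit (human 2026-08-15: routes that do not decide the summit are removed): the assembly concludes `Literature.MathematicalPhysics.QuantumManyBody.BoseGas.BoseEinsteinCondensation`, not the sub-problem statement; a NEW conforming route may be opened from the same idea (generated `closes . The file is kept as the record of this route; refuted decls are indexed as negative knowledge (`ledger negatives`).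

# Route BECJastrowRigidity — Jastrow rigidity — energy minimisation on the pair-product manifold
forces the Riesz-2 tail, its BEC and LHY-sharpness; BEC via a shadow transfer

It suffices to show X = (JASTROW RIGIDITY PACKAGE) ∧ (SHADOW TRANSFER) ∧ (BOUNDARY TRANSFER),
realising card
jastrow-rigidity-euler-lagrange (spine). Work on the torus of side L = (N/ρ)^(1/3) and on the
PAIR-PRODUCT (Jastrow) MANIFOLD
𝓙(N,L) = {Ψ_φ = ∏_(i<j) φ(x_i − x_j)/‖·‖ : φ ∈ C¹ even, 0 ≤ φ ≤ 1, φ = 1 off a ball of radius b <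
L/2} — exactly the in-tree
`IsPairProfile.trialState` states of LSSY Thm 2.2 — with Jastrow infimum E_J(N,L) = inf_𝓙
periodicEnergy. The package says that
on 𝓙, unlike in the full Hilbert space (barrier EnergyAsymptoticsWithoutCondensation), energy is
SHARP: (i) JastrowTailRigidity —
every near-optimal pair factor carries the Reatto–Chester/Riesz-2 tail 1 − φ ≈ (c/4π²ρ)/r², i.e.
|k|·(1−φ)^(k) = 2√(πa/ρ)(1 ± ε)
on all torus modes M/L ≤ |k| ≤ κ√(ρa), uniformly in N; (ii) OptimalJastrowBEC — near-optimal Jastrow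
states have constant-mode
occupation ≥ cN uniformly in N; (iii) JastrowLHYSharp — E_J(N,L)/N ≤ 4πρa(1 + (128/15√π + ε)√(ρa³))
eventually (the pair-product
manifold alone resolves Lee–Huang–Yang; open even after BastiEtAl2026). SHADOW TRANSFER
(JastrowShadowTransfer, the explicitly
CONDITIONAL link delegated to cards riesz-shadow-harmonic-extension R3 /
relative-fisher-landscape-transfer): (ii) ∧ (iii) for v imply
constant-mode BEC of near-minimisers of the full periodic energy (the body of
BECPeriodicReduction.PeriodicBEC at v); BOUNDARY
TRANSFER = the shared item BoundaryTransferWeak (stmt-AtomisticToContinuum-0827).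
Lean: `JastrowTailRigidity ∧ OptimalJastrowBEC ∧ JastrowLHYSharp ∧ JastrowShadowTransfer ∧
BoundaryTransferWeak` (decls of this route — the assembly consumes the last four,
JastrowTailRigidity being the structural theorem behind ranks 3–4 and their foreseen split parent;
every body is spelled out under Cruxes and elaborates in Sketch.lean, rc 0, over the existing
declarations Literature.MathematicalPhysics.QuantumManyBody.BoseGas.{IsRepulsiveFiniteRange,
IsPairProfile, IsPairProfile.trialState, jastrowNormR, periodicEnergy, periodicGroundStateEnergy,
condensateOccupation, PeriodicTrialState, scatteringLength, latticeVec, sideLength,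
HasGroundStateBEC, BoseEinsteinCondensation})

## Assembly
Pure logic (term checked in Sketch.lean: `fun hOJB hLHY hBridge hBTW v hv => hBTW v hv (hBridge v hv
(hOJB v hv) (hLHY v hv))`): fix v repulsive finite-range; OptimalJastrowBEC and JastrowLHYSharp give
their bodies at v; JastrowShadowTransfer turns them into
constant-mode BEC of periodic near-minimisers at v;
BoundaryTransferWeak turns that into ∃ρ₀ ∀ρ<ρ₀ HasGroundStateBEC v ρ, which is the conjunct.
JastrowTailRigidity (rank 2) is not a
hypothesis of the assembly: it is the structure theorem from which ranks 3–4 are expected to follow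
(Two-layer plan) and the statement whose
refutation kills the line.

Rationale: WHY THIS LINE. Mechanism (card jastrow-rigidity-euler-lagrange; physics: ReattoChester1967,
CampbellFeenberg1969 paired-phonon analysis, book:griffin1993 (9.3)
p.183): restricted to positive pair-product states the energy functional has a three-body kinetic
cross term whose long-wavelength Euler–Lagrange
equation ρû(k) ≈ ½(1/S(k) − 1) with S(k) ≈ k/c admits ONLY the exponent-2 tail, and each infrared
band of modes carries an O(8πρa) energy that
pins the tail of near-minimisers scale by scale up to the box (`Jastrow rigidity'); the
phase-texture / number-filter witnesses of energy
blindness are not tangent to the manifold. Imported area: the classical statistical mechanics of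
long-range (Riesz s = d−1 = 2) gases —
|Ψ_φ|² IS a pair-potential Gibbs measure — via LebleSerfaty2017 / Serfaty2020 (thermodynamic limit,
local laws) and FrohlichPark1978-type
correlation inequalities for the structure factor, replacing the cluster expansions of BastiEtAl2024
(which need ρaℓ² ≪ 1 and stop at
(ρa³)^(1/2−ε), Thm 1.1) — BastiEtAl2026 (arXiv:2603.13084, pp. 4–5) obtain the hard-sphere LHY upper
bound only by dressing a
SHORT-range Jastrow operator with a Bogoliubov Fock state and call the pure pair-product route past
the healing length `quite a challenge':
JastrowLHYSharp is that challenge stated. What prior routes do not do: every open BEC route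
(PeriodicReduction, Pinning, PalmLandscape,
ConditionalEntropy, GaussianDomination, VortexSheetDuality, HardSphereComparison, ParticleInduction)
works on the true ground state or on
reformulations of the criterion; none has a variational manifold on which energy ⇒ infrared
structure is a theorem-candidate, and none touches
the Jastrow infimum; the two Jastrow-named routes opened today (BECJastrowKac: exact Kac-window
splitting with a cut-off f, f′(R) = 0; BECParentHamiltonian: a GIVEN short-range pair profile and
its parent Hamiltonian, condensation of the anchor by the union bound (N−1)∫(1−φ²) < L³) fix a
short-range pair factor a priori, whereas here the pair factor is the unknown and the
theorem-candidate is that the optimal one is long-range with exponent 2. Negatives index empty at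
filing.

RANKED CRUXES. #2 JastrowTailRigidity (crux) — (card D2, TAIL THEOREM, uniform-in-N form) for every
repulsive finite-range radial v with 0 < a < ∞ and every ε > 0: for all small ρ there are κ, M > 0
such that for all large N there is δ > 0 with: every Jastrow state Ψ_φ ∈ 𝓙(N,L), L = (N/ρ)^(1/3),
with periodicEnergy ≤ E_J(N,L) + δ has, at every torus mode k = 2πn/L with M/L ≤ |k| ≤ κ√(ρa),
Fourier defect |k|·∫(1−φ(x))cos(k·x)dx within relative ε of 2√(πa/ρ) (= 2π²·mc/(2π²ħρ) with c =
√(16πρa), ħ = 2m = 1: the Riesz-2 / Reatto–Chester class, and no other exponent). [difficulty: XL]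
(why it might fail: needs the f-gas structure factor as a functional of the tail down to k≈M/L
(perfect-screening sum rules for a Riesz-2 gas: open) plus mode-by-mode strict convexity with the
3-body term; the Jastrow sound velocity may differ from √(16πρa) beyond leading order.)
[ReattoChester1967, CampbellFeenberg1969, book:griffin1993-excitations-bose-condensed-liquid p.183
(9.3), LebleSerfaty2017, Serfaty2020, arXiv:2603.13084 pp.4-5]
#3 OptimalJastrowBEC (crux) — (card D3) for every repulsive finite-range radial v there is ρ₀ > 0
such that for 0 < ρ < ρ₀ there is c > 0 with: for all large N there is δ > 0 such that every Jastrow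
state Ψ_φ ∈ 𝓙(N,L), L = (N/ρ)^(1/3), with periodicEnergy v Ψ_φ ≤ E_J(N,L) + δ has constant-mode
occupation ⟨Ψ_φ, n₀ Ψ_φ⟩ ≥ cN. For positive product states n₀/N = ⟨e^(−U(x)−U(x′))⟩/⟨e^(−2U(x))⟩ is
a Widom-insertion ratio of the classical gas |Ψ_φ|² (PenroseOnsager1956 §6, Reatto1969); at Gaussian
level n₀/N ≈ exp(−ρ∫|û|²S d³k/(2π)³) = exp(−O(√(ρa³))) for the Riesz-2 tail. The elementary anchor
bound n₀/N ≥ (1 − (N−1)∫(1−φ²)/L³)² (route BECParentHamiltonian, JastrowAnchorBEC; likewise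
BECRigidityTolerance.DiluteJastrowTolerance) is void here: for a Riesz-2 tail kept up to the box,
∫(1−φ²) ≍ 4π√(a/π³ρ)·L, so (N−1)∫(1−φ²)/L³ → ∞ — this crux is the long-range regime those items
exclude. [deps: JastrowTailRigidity] [difficulty: XL] (why it might fail: near-optimality controls φ
only through the quadratic form; BEC needs exponential moments of the insertion energy U=Σu(x−y_j)
of a hard-core + 1/r² gas (not of positive type globally), i.e. an infrared bound S(k)≲k/(ρ b) for
the f-gas uniformly in N.) [Reatto1969, PenroseOnsager1956, FrohlichPark1978, LebleSerfaty2017,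
ReattoChester1967]
#4 JastrowLHYSharp (crux) — (card D4, sharpened after BastiEtAl2026) the pair-product manifold alone
is Lee–Huang–Yang sharp: for every repulsive finite-range radial v with a < ∞ and every ε > 0, for
all small ρ, eventually in N, E_J(N,L) ≤ 4πρa[1 + (128/(15√π) + ε)√(ρa³)]·N with L = (N/ρ)^(1/3).
Known: (ρa³)^(1/2−ε) with a cut-off pair factor (BastiEtAl2024 Thm 1.1); LHY itself for hard spheres
only with a Jastrow∘Bogoliubov Fock state (BastiEtAl2026 Thm 1.1, who name the pure-Jastrow version
an open challenge, pp. 4–5); lower bound FournaisSolovej2022. [difficulty: XL] (why it might fail: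
inf over pair-product states may miss part of the LHY constant (3-body kinetic cross term must be
o(ρa√(ρa³)) per particle after optimisation — true in HNC/EL closure only); evaluating a Jastrow
factor with tail beyond (ρa)^(-1/2) has no convergent expansion.) [arXiv:2603.13084 Thm 1.1 and
pp.4-5, BastiEtAl2024, BastiCenatiempoSchlein2021, FournaisSolovej2022, CampbellFeenberg1969,
LSSY2005 Thm 2.2]
#5 JastrowShadowTransfer (crux) — (BRIDGE — the explicitly CONDITIONAL link, delegated by the card
to riesz-shadow-harmonic-extension R3 / relative-fisher-landscape-transfer /
riccati-cluster-ghost-plasma) for each repulsive finite-range radial v: if near-optimal Jastrow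
states condense uniformly (body of OptimalJastrowBEC at v) and the Jastrow infimum is LHY-sharp
(body of JastrowLHYSharp at v), then near-minimisers of the FULL periodic energy have constant-mode
occupation ≥ cN at all small ρ (the body of BECPeriodicReduction.PeriodicBEC at v). Intended
mechanism: Ψ₀ = Ψ_(φ*)·Φ with a dressing Φ of bounded insertion landscape relative to the
LHY-accurate, condensed, Riesz-2 reference gas. [deps: OptimalJastrowBEC, JastrowLHYSharp]
[difficulty: open-problem] (why it might fail: no transfer of condensation from an LHY-accurate
trial state to Ψ₀ is known beyond scales ℓ with ℓ²·(excess energy per particle)≪1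
(KineticGapLengthScales); without a structural input on Ψ₀/Ψ_(φ*) this is PeriodicBEC in disguise.)
[LSSY2005 Ch.5, Fournais2020 Thm 1.2, arXiv:2603.20776, Reatto1969,
Literature.Barriers.AtomisticToContinuum.EnergyAsymptoticsWithoutCondensation,
Literature.Barriers.AtomisticToContinuum.KineticGapLengthScales]
#6 BoundaryTransferWeak (crux) — (shared item stmt-AtomisticToContinuum-0827 of route
BECPeriodicReduction, verbatim) for each repulsive finite-range v, constant-mode BEC of
near-minimisers of the periodic energy at all small ρ implies the conjunct's Dirichlet, mode-free
HasGroundStateBEC v ρ at all small ρ. [deps: JastrowShadowTransfer] [difficulty: L] (why it might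
fail: near-minimiser slacks are O(N/L²) while Dirichlet and periodic energies differ by a wall term
≫ N/L², so no energy-comparison proof; a structural (Neumann-bracketing + mode-free criterion)
transfer is not in print (only the energy analogue, LSSY Ch.2).) [LSSY2005 Ch.2 after (2.8),
Basti2022, BoccatoSeiringer2023, Robinson1976]
#9 JastrowInfLeadingOrder (support) — (non-vacuity / provable now) Dyson–LSSY leading-order bound
for the Jastrow infimum: for finite-range v with a < ∞ there are C, c > 0 such that for N ≥ 2, 0 <
L, 2R₀ < L and a/b ≤ c (ρ₁ = (N−1)/L³, b = (4πρ₁/3)^(−1/3)): E_J(N,L) ≤ 4πρ₁a(1 + C a/b)N. Same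
trial state as the in-tree proof of LSSY2005_upperBound_periodic (IsPairProfile.trialState with
cut-off b/4): replace periodicGroundStateEnergy_le by iInf_le over the manifold data. Certifies E_J
< ⊤ in the dilute regime, so the near-optimality hypotheses of ranks 2–3 are not vacuous.
[difficulty: provable-now] [LSSY2005 Thm 2.2 (2.14)–(2.33), Dyson1957, in-tree
Literature.MathematicalPhysics.QuantumManyBody.BoseGas.LSSY2005_jastrowBound_holds]

TWO-LAYER PLAN. Foreseen glued splits (none filed now; k ≤ 3, depth 1): JastrowTailRigidity ⇐
JastrowFunctionalTL (card D1: thermodynamic limit of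
E_J on the Riesz-s tailed classes 𝓕_(s,β), 0 < s < 3, incl. the 3-point term, from LebleSerfaty2017
local laws) → TailStationarity
(only (s,β) = (2, c/4π²ρ) is stationary; scale-by-scale excess ≥ c₁·8πρa·#{modes} ·
d((s,β),(2,β*))²) → JastrowTailRigidity.
OptimalJastrowBEC ⇐ JastrowTailRigidity → RieszTailCondenses (BEC of every Jastrow state whose low
modes are Riesz-2 within ε:
infrared bound S(k) ≲ k for the f-gas + exponential moments of the insertion energy) →
OptimalJastrowBEC. JastrowLHYSharp ⇐
JastrowFunctionalTL → RieszTrialEvaluation (energy of core × Riesz-2-tail profile to relative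
o(√(ρa³)) by long-range-gas local laws
instead of cluster expansion) → JastrowLHYSharp.

KILL CRITERIA. ¬JastrowTailRigidity by an explicit competitor (a cut-off or s ≠ 2 tailed pair factor
whose energy is within o(1) TOTAL of E_J for
arbitrarily large N, or a proof that inf_𝓙 is approached by short-range factors) closes the route
`refuted:JastrowTailRigidity` — the
mechanism is dead even if OptimalJastrowBEC survives. ¬JastrowLHYSharp (inf over pair-product states
misses the LHY constant) forces a
pivot: drop rank 4 from the bridge hypotheses, keep the tail/BEC line (the manifold is then
infrared-sharp but not LHY-sharp — still
new). ¬OptimalJastrowBEC kills the route and, physically, the Jastrow picture of the condensate.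
¬JastrowShadowTransfer cannot be
refuted without refuting PeriodicBEC-type statements; if PeriodicBEC (stmt-0826) is proved elsewhere
the bridge and rank 6 are moot and
the route closes `superseded`, its ranks 2–4 surviving as structure theorems. ¬BoundaryTransferWeak
breaks this and three other routes.

NOT DECOMPOSED YET. The thermodynamic-limit functional (card D1) and the Riesz-class parametrisation
𝓕_(s,β) — layer-2 children once rank 2 is staffed; the
quantitative excess bound (slack θ·8πρa·(L/R)³ ⇒ accuracy at scale R) — stated informally only, the
filed rank 2 is its δ → 0 shadow;
the Jackson–Feenberg identity on the torus for C¹ pair factors with hard core (card D5, a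
`--supports JastrowTailRigidity` lemma, not
an item); hard-core versus soft-core case splits; the value of c in OptimalJastrowBEC (expected 1 −
O(√(ρa³))); everything about the
dressing Φ = Ψ₀/Ψ_(φ*) (belongs to the bridge's owner cards).

CHEAPEST FALSIFIER. Variational Monte Carlo (kit, not run here — hub is compute-free and this is a
one-shot planning seat): N = 10³–10⁴ hard spheres at
ρa³ = 10⁻³ on the torus, pair factor = (1 − a/r)₊-core × Riesz-s tail of amplitude β cut off at L/2,
scan (s, β): (i) is the energy
minimum at s = 2, β ≈ √(a/π³ρ)? (ii) does E(s) − E(2) stay ≳ 8πρa·#{modes below 1/R} when the tails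
differ only beyond R? (iii) is
E_J/N below 4πρa(1 + 1.2·(128/15√π)√(ρa³))? A flat landscape in s at resolution 8πρa TOTAL, or E_J/N
stuck above LHY by a fixed
fraction of the correction, kills ranks 2 / 4 respectively in practice. Lookup falsifier already
run: is the pure-Jastrow LHY bound in
print? — no (arXiv:2603.13084 pp. 4–5 state the opposite).

NUMBERS. LHY: e(ρ) = 4πaρ²[1 + (128/15√π)√(ρa³) + …], 128/(15√π) ≈ 4.814; hard spheres: upper bound
with this constant + C(ρa³)^(1/2+δ)
(arXiv:2603.13084 Thm 1.1, Jastrow∘Bogoliubov state, 586 pp.); pure cut-off Jastrow: 4πρa[1 +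
C(ρa³)^(1/2−ε)] (BastiEtAl2024 Thm 1.1,
ℓ = c(ρa)^(−1/2)); Dyson/LSSY product state: 4πρ₁a(1 + 12 a/b) in tree (jastrow_optimisation, C =
12). Units ħ = 2m = 1: c = √(16πρa),
healing length (16πρa)^(−1/2), Reatto–Chester amplitude mc/(2π²ħρ) = c/(4π²ρ) = √(a/π³ρ), predicted
|k|·(1−φ)^(k) → 2√(πa/ρ);
Bogoliubov depletion (8/3√π)√(ρa³). Items at open: 7 (5 cruxes, 1 support, 1 assembly).

DEFINITION REQUESTS. None needed to type the items (the Jastrow infimum is inlined as an iInf over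
the IsPairProfile.trialState data). Convenience notion to be
requested after open: `jastrowGroundStateEnergy v N L` (that iInf) in
Literature/MathematicalPhysics/QuantumManyBody, and later (layer 2)
`RieszTailedProfile s β` for card D1.

Novelty: Searches (2026-08-15): `lit search --source s2 "hard sphere Bose gas upper bound Lee-Huang-Yang"
--year-from 2023` (7 rows: arXiv:2603.13084,
arXiv:2605.06844, arXiv:2405.03378, arXiv:2408.14222 …; openalex/arxiv HTTP 429, local searchd
reset); `lit read arXiv:2212.04431 pp.1-4`
(Thm 1.1), `lit read arXiv:2603.13084 pp.1-6` (Thm 1.1, trial state, the pp.4-5 remark), `lit read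
arXiv:2605.06844 pp.1-3`;
`lit vsearch "optimal Jastrow pair function … 1/r^2 … Euler-Lagrange …"` (10 docs; book:griffin1993
p.183 (9.3) = Reatto–Chester tail);
`lit frontier AtomisticToContinuum --since 2023` (30 rows; Bose-gas descendants arXiv:2510.20493,
2603.20776, 2605.06844, 2602.16566 — none
variational-Jastrow); `lit bridges AtomisticToContinuum --cross any` (no Riesz-gas/Bose-gas bridge);
`lit galaxy search "paired-phonon
analysis" --star all` (galaxyd queue timeout, 0 rows); card audit-12 searches inherited (zbMATH ×3:
0; crossref: HNC/EL physics only).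
Nearest prior art found: ReattoChester1967 + CampbellFeenberg1969 (+ Lantto–Siemens 1977, Krotscheck
HNC-EL: the closure-level answer
s = 2, u ~ mc/2π²ħρr²); Reatto1969 (ODLRO survives the 1/r² tail, cumulant estimate); BastiEtAl2024
(arXiv:2212.04431, cut-off Jastrow,
(ρa³)^(1/2−ε)); BastiEtAl2026 (arXiv:2603.13084: hard-sphere LHY upper bound by Jastrow∘Bogoliubov,
pure Jastrow beyond the healing
length named an open challenge); LebleSerfaty2017 (Riesz-gas LDP).
Delta: a rigorous variational theory OF the optimal pair factor — near-optimalit  [refs: 2603.13084, 2605.06844, 2405.03378, 2408.14222, 2212.04431, 2510.20493, book:griffin1993, ReattoChester1967, CampbellFeenberg1969, Reatto1969, BastiEtAl2024, BastiEtAl2026, LebleSerfaty2017]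

Barriers (technique_class: jastrow-variational euler-lagrange riesz-gas): - technique_class: jastrow-variational euler-lagrange riesz-gas
- Literature.Barriers.AtomisticToContinuum.EnergyAsymptoticsWithoutCondensation: confronted, not
evaded: energy ⇒ structure is claimed ONLY on the pair-product manifold, whose members are positive
product states — the 1-D witness (Lieb–Liniger: the optimal 1-D Jastrow is the log gas, s = 0, no
BEC) is consistent with ranks 2–3 being d = 3 statements, and the 3-D witnesses (phase textures,
number filters) are not tangent to the manifold; the inference to Ψ₀ is isolated in the bridge (rank
5), which is where the barrier bites and is labelled conditional.
- Literature.Barriers.AtomisticToContinuum.EnergyAsymptoticsWithoutCondensationNarrow: ranks 2–4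
infer structure of EXPLICIT trial states from the energy functional restricted to a manifold (second
variation mode by mode), not HasGroundStateBEC from two orders of e₀(ρ); rank 5 does draw on
LHY-accuracy of a trial state and does not evade the entry — the bet is that positivity + Riesz-2
structure of the reference state is the extra input.
- Literature.Barriers.AtomisticToContinuum.KineticGapLengthScales: ranks 2–4 never localise in boxes
(scale-by-scale = bands of torus modes of ONE global state); rank 5 is exactly where every known
transfer pays ℓ²×(excess energy) — it does not evade it; the bet is a landscape/positivity transfer
(cards relative-fisher-landscape-transfer, riesz-shadow-harmonic-extension).
- Literature.Barriers.AtomisticToContinuum.BogoliubovPerturb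

Novelty grade: new-combination — ROUTE REVIEW (refuter rreview-13955765, 2026-08-15). NB: route RETIRED by operator glue-backfill 13:39Z ('assembly does not conclude the sub-problem Statement') during this review. EVIDENCE OF A TEXTUAL FALSE POSITIVE: the Assembly concludes `Literature.MathematicalPhysics.QuantumManyBody.BoseGas.Bo (refuter refuter-rreview-route-AtomisticToContinu-13955765-0, 2026-08-15T14:00:48Z; prior: doi:10.1103/physrev.155.88 (Reatto-Chester 1967), doi:10.1103/PhysRev.188.396 (Campbell-Feenberg 1969), Reatto PR 183:334 (1969), arXiv:2212.04431 (BastiEtAl2024 Thm 1.1), arXiv:2603.13084 (BastiEtAl2026 Thm 1.1, pp.4-5), arXiv:1502.02970 (Leble-Serfaty), LSSY2005 Thm 2.2)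

History (route lifecycle, newest last):
- 2026-08-15T12:09:47Z · rev 1: restated Assembly (stmt-AtomisticToContinuum-6361) — restate Assembly: inline the shared hypothesis stmt-0827 verbatim (the post-open attach of 0827 left it outside the route structure); no change of meaning (planner-plancard-AtomisticToContinuum-BoseEin-7e90b8c6-0)
- 2026-08-15T13:39:03Z · CLOSED retired — not-a-thesis: assembly does not conclude the sub-problem Statement (operator:999:1257524)

sub-problem: BoseEinsteinCondensation · status: closed(retired) · opened planner-plancard-AtomisticToContinuum-BoseEin-7e90b8c6-0 2026-08-15T11:46:11Z · rev 0 · ledger route-AtomisticToContinuum-BECJastrowRigidity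
GENERATED by the gate from the ledger (D-0016/17). Provers cite these decls: `theorem foo : Summit.AtomisticToContinuum.BoseEinsteinCondensation.Theses.BECJastrowRigidity.<Decl> := …` in Summits/AtomisticToContinuum/BoseEinsteinCondensation/Theorems/<Name>.lean.
-/

namespace Summit.AtomisticToContinuum.BoseEinsteinCondensation.Theses.BECJastrowRigidity

open scoped BigOperators Topology Manifold Classical MeasureTheory ProbabilityTheory Matrix InnerProductSpace ComplexConjugate ContinuousMap
open Filter Set Function TopologicalSpace MeasureTheory

attribute [summit_statement] _root_.BoseEinsteinCondensation

/-- item stmt-AtomisticToContinuum-6356 · crux · rank 2 · closed · moot by None · by planner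
why it might fail: needs the f-gas structure factor as a functional of the tail down to k≈M/L (perfect-screening sum rules for a Riesz-2 gas: open) plus mode-by-mode strict convexity with the 3-body term; the Jastrow sound velocity may differ from √(16πρa) beyond leading order.
sources: ReattoChester1967, CampbellFeenberg1969, book:griffin1993-excitations-bose-condensed-liquid p.183 (9.3), LebleSerfaty2017, Serfaty2020, arXiv:2603.13084 pp.4-5
[crux] (card D2, TAIL THEOREM, uniform-in-N form) for every repulsive finite-range radial v with 0 <
a < ∞ and every ε > 0: for all small ρ there are κ, M > 0 such that for all large N there is δ > 0
with: every Jastrow state Ψ_φ ∈ 𝓙(N,L), L = (N/ρ)^(1/3), with periodicEnergy ≤ E_J(N,L) + δ has, at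
every torus mode k = 2πn/L with M/L ≤ |k| ≤ κ√(ρa), Fourier defect |k|·∫(1−φ(x))cos(k·x)dx within
relative ε of 2√(πa/ρ) (= 2π²·mc/(2π²ħρ) with c = √(16πρa), ħ = 2m = 1: the Riesz-2 / Reatto–Chester
class, and no other exponent). [difficulty: XL] -/
@[route_item "route-AtomisticToContinuum-BECJastrowRigidity"]
def JastrowTailRigidity : Prop :=
  ∀ v : ℝ → ENNReal, Literature.MathematicalPhysics.QuantumManyBody.BoseGas.IsRepulsiveFiniteRange v → Literature.MathematicalPhysics.QuantumManyBody.BoseGas.scatteringLength v ≠ ⊤ → 0 < Literature.MathematicalPhysics.QuantumManyBody.BoseGas.scatteringLength v → ∀ ε : ℝ, 0 < ε → ∃ ρ₀ : ℝ, 0 < ρ₀ ∧ ∀ ρ : ℝ, 0 < ρ → ρ < ρ₀ → ∃ κ M : ℝ, 0 < κ ∧ 0 < M ∧ ∀ᶠ N : ℕ in Filter.atTop, ∃ δ : ENNReal, 0 < δ ∧ ∀ (hL : 0 < (Literature.MathematicalPhysics.QuantumManyBody.BoseGas.sideLength ρ N)) (b : ℝ) (φ : EuclideanSpace ℝ (Fin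 3) → ℝ) (hφ : Literature.MathematicalPhysics.QuantumManyBody.BoseGas.IsPairProfile b φ) (hbL : 2 * b < (Literature.MathematicalPhysics.QuantumManyBody.BoseGas.sideLength ρ N)) (hν : 0 < Literature.MathematicalPhysics.QuantumManyBody.BoseGas.jastrowNormR (Literature.MathematicalPhysics.QuantumManyBody.BoseGas.sideLength ρ N) φ (Finset.univ : Finset (Fin N))), Literature.MathematicalPhysics.QuantumManyBody.BoseGas.periodicEnergy v (hφ.trialState hL hbL hν) ≤ (⨅ (hL : 0 < (Literature.MathematicalPhysics.QuantumManyBody.BoseGas.sideLength ρ N)) (b : ℝ) (φ : EuclideanSpace ℝ (Fin 3) → ℝ) (hφ : Literature.MathematicalPhysics.QuantumManyBody.BoseGas.IsPairProfile b φ) (hbL : 2 * b < (Literature.MathematicalPhysics.QuantumManyBody.BoseGas.sideLength ρ N)) (hν : 0 < Literature.MathematicalPhysics.QuantumManyBody.BoseGas.jastrowNormR (Literature.MathematicalPhysics.QuantumManyBody.BoseGas.sideLength ρ N) φ (Finset.univ : Finset (Fin N))), Literature.MathematicalPhysics.QuantumManyBody.BoseGas.periodicEnergy v (hφ.trialState hL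 hbL hν)) + δ → ∀ n : Fin 3 → ℤ, M / Literature.MathematicalPhysics.QuantumManyBody.BoseGas.sideLength ρ N ≤ ‖(Literature.MathematicalPhysics.QuantumManyBody.BoseGas.latticeVec (2 * Real.pi / Literature.MathematicalPhysics.QuantumManyBody.BoseGas.sideLength ρ N) n)‖ → ‖(Literature.MathematicalPhysics.QuantumManyBody.BoseGas.latticeVec (2 * Real.pi / Literature.MathematicalPhysics.QuantumManyBody.BoseGas.sideLength ρ N) n)‖ ≤ κ * Real.sqrt (ρ * (Literature.MathematicalPhysics.QuantumManyBody.BoseGas.scatteringLength v).toReal) → |‖(Literature.MathematicalPhysics.QuantumManyBody.BoseGas.latticeVec (2 * Real.pi / Literature.MathematicalPhysics.QuantumManyBody.BoseGas.sideLength ρ N) n)‖ * (∫ x : EuclideanSpace ℝ (Fin 3), (1 - φ x) * Real.cos (inner ℝ (Literature.MathematicalPhysics.QuantumManyBody.BoseGas.latticeVec (2 * Real.pi / Literature.MathematicalPhysics.QuantumManyBody.BoseGas.sideLength ρ N) n) x)) - (2 * Real.sqrt (Real.pi * (Literature.MathematicalPhysics.QuantumManyBody.BoseGas.scatteringLength v).toReal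 / ρ))| ≤ ε * (2 * Real.sqrt (Real.pi * (Literature.MathematicalPhysics.QuantumManyBody.BoseGas.scatteringLength v).toReal / ρ))

/-- item stmt-AtomisticToContinuum-6357 · crux · rank 3 · closed · moot by None · by planner
why it might fail: near-optimality controls φ only through the quadratic form; BEC needs exponential moments of the insertion energy U=Σu(x−y_j) of a hard-core + 1/r² gas (not of positive type globally), i.e. an infrared bound S(k)≲k/(ρ b) for the f-gas uniformly in N.
sources: Reatto1969, PenroseOnsager1956, FrohlichPark1978, LebleSerfaty2017, ReattoChester1967
[crux] (card D3) for every repulsive finite-range radial v there is ρ₀ > 0 such that for 0 < ρ < ρ₀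
there is c > 0 with: for all large N there is δ > 0 such that every Jastrow state Ψ_φ ∈ 𝓙(N,L), L =
(N/ρ)^(1/3), with periodicEnergy v Ψ_φ ≤ E_J(N,L) + δ has constant-mode occupation ⟨Ψ_φ, n₀ Ψ_φ⟩ ≥
cN. For positive product states n₀/N = ⟨e^(−U(x)−U(x′))⟩/⟨e^(−2U(x))⟩ is a Widom-insertion ratio of
the classical gas |Ψ_φ|² (PenroseOnsager1956 §6, Reatto1969); at Gaussian level n₀/N ≈ exp(−ρ∫|û|²S
d³k/(2π)³) = exp(−O(√(ρa³))) for the Riesz-2 tail. The elementary anchor bound n₀/N ≥ (1 −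
(N−1)∫(1−φ²)/L³)² (route BECParentHamiltonian, JastrowAnchorBEC; likewise
BECRigidityTolerance.DiluteJastrowTolerance) is void here: for a Riesz-2 tail kept up to the box,
∫(1−φ²) ≍ 4π√(a/π³ρ)·L, so (N−1)∫(1−φ²)/L³ → ∞ — this crux is the long-range regime those items
exclude. [deps: JastrowTailRigidity] [difficulty: XL] -/
@[route_item "route-AtomisticToContinuum-BECJastrowRigidity"]
def OptimalJastrowBEC : Prop :=
  ∀ v : ℝ → ENNReal, Literature.MathematicalPhysics.QuantumManyBody.BoseGas.IsRepulsiveFiniteRange v → ∃ ρ₀ : ℝ, 0 < ρ₀ ∧ ∀ ρ : ℝ, 0 < ρ → ρ < ρ₀ → ∃ c : ℝ, 0 < c ∧ ∀ᶠ N : ℕ in Filter.atTop, ∃ δ : ENNReal, 0 < δ ∧ ∀ (hL : 0 < (Literature.MathematicalPhysics.QuantumManyBody.BoseGas.sideLength ρ N)) (b : ℝ) (φ : EuclideanSpace ℝ (Fin 3) → ℝ) (hφ : Literature.MathematicalPhysics.QuantumManyBody.BoseGas.IsPairProfile b φ) (hbL : 2 * b < (Literature.MathematicalPhysics.QuantumManyBody.BoseGas.sideLength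 ρ N)) (hν : 0 < Literature.MathematicalPhysics.QuantumManyBody.BoseGas.jastrowNormR (Literature.MathematicalPhysics.QuantumManyBody.BoseGas.sideLength ρ N) φ (Finset.univ : Finset (Fin N))), Literature.MathematicalPhysics.QuantumManyBody.BoseGas.periodicEnergy v (hφ.trialState hL hbL hν) ≤ (⨅ (hL : 0 < (Literature.MathematicalPhysics.QuantumManyBody.BoseGas.sideLength ρ N)) (b : ℝ) (φ : EuclideanSpace ℝ (Fin 3) → ℝ) (hφ : Literature.MathematicalPhysics.QuantumManyBody.BoseGas.IsPairProfile b φ) (hbL : 2 * b < (Literature.MathematicalPhysics.QuantumManyBody.BoseGas.sideLength ρ N)) (hν : 0 < Literature.MathematicalPhysics.QuantumManyBody.BoseGas.jastrowNormR (Literature.MathematicalPhysics.QuantumManyBody.BoseGas.sideLength ρ N) φ (Finset.univ : Finset (Fin N))), Literature.MathematicalPhysics.QuantumManyBody.BoseGas.periodicEnergy v (hφ.trialState hL hbL hν)) + δ → ENNReal.ofReal (c * N) ≤ Literature.MathematicalPhysics.QuantumManyBody.BoseGas.condensateOccupation N (Literature.MathematicalPhysics.QuantumManyBody.BoseGas.sideLength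 ρ N) (hφ.trialState hL hbL hν).ψ

/-- item stmt-AtomisticToContinuum-6358 · crux · rank 4 · closed · moot by None · by planner
why it might fail: inf over pair-product states may miss part of the LHY constant (3-body kinetic cross term must be o(ρa√(ρa³)) per particle after optimisation — true in HNC/EL closure only); evaluating a Jastrow factor with tail beyond (ρa)^(-1/2) has no convergent expansion.
sources: arXiv:2603.13084 Thm 1.1 and pp.4-5, BastiEtAl2024, BastiCenatiempoSchlein2021, FournaisSolovej2022, CampbellFeenberg1969, LSSY2005 Thm 2.2
[crux] (card D4, sharpened after BastiEtAl2026) the pair-product manifold alone is Lee–Huang–Yang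
sharp: for every repulsive finite-range radial v with a < ∞ and every ε > 0, for all small ρ,
eventually in N, E_J(N,L) ≤ 4πρa[1 + (128/(15√π) + ε)√(ρa³)]·N with L = (N/ρ)^(1/3). Known:
(ρa³)^(1/2−ε) with a cut-off pair factor (BastiEtAl2024 Thm 1.1); LHY itself for hard spheres only
with a Jastrow∘Bogoliubov Fock state (BastiEtAl2026 Thm 1.1, who name the pure-Jastrow version an
open challenge, pp. 4–5); lower bound FournaisSolovej2022. [difficulty: XL] -/
@[route_item "route-AtomisticToContinuum-BECJastrowRigidity"]
def JastrowLHYSharp : Prop :=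
  ∀ v : ℝ → ENNReal, Literature.MathematicalPhysics.QuantumManyBody.BoseGas.IsRepulsiveFiniteRange v → Literature.MathematicalPhysics.QuantumManyBody.BoseGas.scatteringLength v ≠ ⊤ → ∀ ε : ℝ, 0 < ε → ∃ ρ₀ : ℝ, 0 < ρ₀ ∧ ∀ ρ : ℝ, 0 < ρ → ρ < ρ₀ → ∀ᶠ N : ℕ in Filter.atTop, (⨅ (hL : 0 < (Literature.MathematicalPhysics.QuantumManyBody.BoseGas.sideLength ρ N)) (b : ℝ) (φ : EuclideanSpace ℝ (Fin 3) → ℝ) (hφ : Literature.MathematicalPhysics.QuantumManyBody.BoseGas.IsPairProfile b φ) (hbL : 2 * b < (Literature.MathematicalPhysics.QuantumManyBody.BoseGas.sideLength ρ N)) (hν : 0 < Literature.MathematicalPhysics.QuantumManyBody.BoseGas.jastrowNormR (Literature.MathematicalPhysics.QuantumManyBody.BoseGas.sideLength ρ N) φ (Finset.univ : Finset (Fin N))), Literature.MathematicalPhysics.QuantumManyBody.BoseGas.periodicEnergy v (hφ.trialState hL hbL hν)) ≤ ENNReal.ofReal (4 * Real.pi * ρ * (Literature.MathematicalPhysics.QuantumManyBody.BoseGas.scatteringLength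 v).toReal * (1 + (128 / (15 * Real.sqrt Real.pi) + ε) * Real.sqrt (ρ * (Literature.MathematicalPhysics.QuantumManyBody.BoseGas.scatteringLength v).toReal ^ 3)) * N)

/-- item stmt-AtomisticToContinuum-6359 · crux · rank 5 · closed · moot by None · by planner
why it might fail: no transfer of condensation from an LHY-accurate trial state to Ψ₀ is known beyond scales ℓ with ℓ²·(excess energy per particle)≪1 (KineticGapLengthScales); without a structural input on Ψ₀/Ψ_(φ*) this is PeriodicBEC in disguise.
sources: LSSY2005 Ch.5, Fournais2020 Thm 1.2, arXiv:2603.20776, Reatto1969, Literature.Barriers.AtomisticToContinuum.EnergyAsymptoticsWithoutCondensation, Literature.Barriers.AtomisticToContinuum.KineticGapLengthScales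
[crux] (BRIDGE — the explicitly CONDITIONAL link, delegated by the card to
riesz-shadow-harmonic-extension R3 / relative-fisher-landscape-transfer /
riccati-cluster-ghost-plasma) for each repulsive finite-range radial v: if near-optimal Jastrow
states condense uniformly (body of OptimalJastrowBEC at v) and the Jastrow infimum is LHY-sharp
(body of JastrowLHYSharp at v), then near-minimisers of the FULL periodic energy have constant-mode
occupation ≥ cN at all small ρ (the body of BECPeriodicReduction.PeriodicBEC at v). Intended
mechanism: Ψ₀ = Ψ_(φ*)·Φ with a dressing Φ of bounded insertion landscape relative to the
LHY-accurate, condensed, Riesz-2 reference gas. [deps: OptimalJastrowBEC, JastrowLHYSharp]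
[difficulty: open-problem] -/
@[route_item "route-AtomisticToContinuum-BECJastrowRigidity"]
def JastrowShadowTransfer : Prop :=
  ∀ v : ℝ → ENNReal, Literature.MathematicalPhysics.QuantumManyBody.BoseGas.IsRepulsiveFiniteRange v → (∃ ρ₀ : ℝ, 0 < ρ₀ ∧ ∀ ρ : ℝ, 0 < ρ → ρ < ρ₀ → ∃ c : ℝ, 0 < c ∧ ∀ᶠ N : ℕ in Filter.atTop, ∃ δ : ENNReal, 0 < δ ∧ ∀ (hL : 0 < (Literature.MathematicalPhysics.QuantumManyBody.BoseGas.sideLength ρ N)) (b : ℝ) (φ : EuclideanSpace ℝ (Fin 3) → ℝ) (hφ : Literature.MathematicalPhysics.QuantumManyBody.BoseGas.IsPairProfile b φ) (hbL : 2 * b < (Literature.MathematicalPhysics.QuantumManyBody.BoseGas.sideLength ρ N)) (hν : 0 < Literature.MathematicalPhysics.QuantumManyBody.BoseGas.jastrowNormR (Literature.MathematicalPhysics.QuantumManyBody.BoseGas.sideLength ρ N) φ (Finset.univ : Finset (Fin N))), Literature.MathematicalPhysics.QuantumManyBody.BoseGas.periodicEnergy v (hφ.trialState hL hbL hν) ≤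 (⨅ (hL : 0 < (Literature.MathematicalPhysics.QuantumManyBody.BoseGas.sideLength ρ N)) (b : ℝ) (φ : EuclideanSpace ℝ (Fin 3) → ℝ) (hφ : Literature.MathematicalPhysics.QuantumManyBody.BoseGas.IsPairProfile b φ) (hbL : 2 * b < (Literature.MathematicalPhysics.QuantumManyBody.BoseGas.sideLength ρ N)) (hν : 0 < Literature.MathematicalPhysics.QuantumManyBody.BoseGas.jastrowNormR (Literature.MathematicalPhysics.QuantumManyBody.BoseGas.sideLength ρ N) φ (Finset.univ : Finset (Fin N))), Literature.MathematicalPhysics.QuantumManyBody.BoseGas.periodicEnergy v (hφ.trialState hL hbL hν)) + δ → ENNReal.ofReal (c * N) ≤ Literature.MathematicalPhysics.QuantumManyBody.BoseGas.condensateOccupation N (Literature.MathematicalPhysics.QuantumManyBody.BoseGas.sideLength ρ N) (hφ.trialState hL hbL hν).ψ) → (Literature.MathematicalPhysics.QuantumManyBody.BoseGas.scatteringLength v ≠ ⊤ → ∀ ε : ℝ, 0 < ε → ∃ ρ₀ : ℝ, 0 < ρ₀ ∧ ∀ ρ : ℝ, 0 < ρ → ρ < ρ₀ → ∀ᶠ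 N : ℕ in Filter.atTop, (⨅ (hL : 0 < (Literature.MathematicalPhysics.QuantumManyBody.BoseGas.sideLength ρ N)) (b : ℝ) (φ : EuclideanSpace ℝ (Fin 3) → ℝ) (hφ : Literature.MathematicalPhysics.QuantumManyBody.BoseGas.IsPairProfile b φ) (hbL : 2 * b < (Literature.MathematicalPhysics.QuantumManyBody.BoseGas.sideLength ρ N)) (hν : 0 < Literature.MathematicalPhysics.QuantumManyBody.BoseGas.jastrowNormR (Literature.MathematicalPhysics.QuantumManyBody.BoseGas.sideLength ρ N) φ (Finset.univ : Finset (Fin N))), Literature.MathematicalPhysics.QuantumManyBody.BoseGas.periodicEnergy v (hφ.trialState hL hbL hν)) ≤ ENNReal.ofReal (4 * Real.pi * ρ * (Literature.MathematicalPhysics.QuantumManyBody.BoseGas.scatteringLength v).toReal * (1 + (128 / (15 * Real.sqrt Real.pi) + ε) * Real.sqrt (ρ * (Literature.MathematicalPhysics.QuantumManyBody.BoseGas.scatteringLength v).toReal ^ 3)) * N)) → ∃ ρ₀ : ℝ, 0 < ρ₀ ∧ ∀ ρ : ℝ, 0 < ρ → ρ < ρ₀ → ∃ c : ℝ, 0 <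 c ∧ ∀ᶠ N : ℕ in Filter.atTop, ∃ δ : ENNReal, 0 < δ ∧ ∀ Ψ : Literature.MathematicalPhysics.QuantumManyBody.BoseGas.PeriodicTrialState N (Literature.MathematicalPhysics.QuantumManyBody.BoseGas.sideLength ρ N), Literature.MathematicalPhysics.QuantumManyBody.BoseGas.periodicEnergy v Ψ ≤ Literature.MathematicalPhysics.QuantumManyBody.BoseGas.periodicGroundStateEnergy v N (Literature.MathematicalPhysics.QuantumManyBody.BoseGas.sideLength ρ N) + δ → ENNReal.ofReal (c * N) ≤ Literature.MathematicalPhysics.QuantumManyBody.BoseGas.condensateOccupation N (Literature.MathematicalPhysics.QuantumManyBody.BoseGas.sideLength ρ N) Ψ.ψ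

/-- item stmt-AtomisticToContinuum-6360 · support · rank 9 · closed · moot by None · by planner
sources: LSSY2005 Thm 2.2 (2.14)–(2.33), Dyson1957, in-tree Literature.MathematicalPhysics.QuantumManyBody.BoseGas.LSSY2005_jastrowBound_holds
[support] (non-vacuity / provable now) Dyson–LSSY leading-order bound for the Jastrow infimum: for
finite-range v with a < ∞ there are C, c > 0 such that for N ≥ 2, 0 < L, 2R₀ < L and a/b ≤ c (ρ₁ =
(N−1)/L³, b = (4πρ₁/3)^(−1/3)): E_J(N,L) ≤ 4πρ₁a(1 + C a/b)N. Same trial state as the in-tree proof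
of LSSY2005_upperBound_periodic (IsPairProfile.trialState with cut-off b/4): replace
periodicGroundStateEnergy_le by iInf_le over the manifold data. Certifies E_J < ⊤ in the dilute
regime, so the near-optimality hypotheses of ranks 2–3 are not vacuous. [difficulty: provable-now] -/
@[route_item "route-AtomisticToContinuum-BECJastrowRigidity"]
def JastrowInfLeadingOrder : Prop :=
  ∀ (v : ℝ → ENNReal) (R₀ : ℝ), Measurable v → (∀ r, R₀ < r → v r = 0) → Literature.MathematicalPhysics.QuantumManyBody.BoseGas.scatteringLength v ≠ ⊤ → ∃ C c : ℝ, 0 < C ∧ 0 < c ∧ ∀ (N : ℕ) (L : ℝ), 2 ≤ N → 0 < L → 2 * R₀ < L → (Literature.MathematicalPhysics.QuantumManyBody.BoseGas.scatteringLength v).toReal / ((4 * Real.pi * (((N : ℝ) - 1) / L ^ 3) / 3) ^ (-(1 : ℝ) / 3)) ≤ c → (⨅ (hL : 0 < L) (b : ℝ) (φ : EuclideanSpace ℝ (Fin 3) → ℝ) (hφ : Literature.MathematicalPhysics.QuantumManyBody.BoseGas.IsPairProfile b φ) (hbL : 2 * b < L) (hν : 0 < Literature.MathematicalPhysics.QuantumManyBody.BoseGas.jastrowNormR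 L φ (Finset.univ : Finset (Fin N))), Literature.MathematicalPhysics.QuantumManyBody.BoseGas.periodicEnergy v (hφ.trialState hL hbL hν)) ≤ ENNReal.ofReal (4 * Real.pi * (((N : ℝ) - 1) / L ^ 3) * (Literature.MathematicalPhysics.QuantumManyBody.BoseGas.scatteringLength v).toReal * (1 + C * ((Literature.MathematicalPhysics.QuantumManyBody.BoseGas.scatteringLength v).toReal / ((4 * Real.pi * (((N : ℝ) - 1) / L ^ 3) / 3) ^ (-(1 : ℝ) / 3)))) * N)

-- earlier Assembly (stmt-AtomisticToContinuum-6361, replaced 2026-08-15T12:09:47Z -> stmt-AtomisticToContinuum-7458): retired by None — OptimalJastrowBEC → JastrowLHYSharp → JastrowShadowTransfer → BoundaryTransferWeak → Literature.MathematicalPhysics.QuantumManyBody.BoseGas.BoseEinsteinCondensation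
/-- item stmt-AtomisticToContinuum-7458 · assembly · rank 1 · closed · moot by None · by planner
sources: LSSY2005 §1.2 and Ch.5, Reatto1969
[assembly] OptimalJastrowBEC → JastrowLHYSharp → JastrowShadowTransfer → BoundaryTransferWeak →
BoseEinsteinCondensation, with hypothesis 4 = the shared crux stmt-AtomisticToContinuum-0827
(BoundaryTransferWeak, home route BECPeriodicReduction) INLINED verbatim so the assembly typechecks
whether or not the shared decl is rendered in this file; term proof (Sketch.lean rc0): fun hOJB hLHY
hBridge hBTW v hv => hBTW v hv (hBridge v hv (hOJB v hv) (hLHY v hv)). -/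
@[route_item "route-AtomisticToContinuum-BECJastrowRigidity"]
def Assembly : Prop :=
  OptimalJastrowBEC → JastrowLHYSharp → JastrowShadowTransfer → (∀ v : ℝ → ENNReal, Literature.MathematicalPhysics.QuantumManyBody.BoseGas.IsRepulsiveFiniteRange v → (∃ ρ₀ : ℝ, 0 < ρ₀ ∧ ∀ ρ : ℝ, 0 < ρ → ρ < ρ₀ → ∃ c : ℝ, 0 < c ∧ ∀ᶠ N : ℕ in Filter.atTop, ∃ δ : ENNReal, 0 < δ ∧ ∀ Ψ : Literature.MathematicalPhysics.QuantumManyBody.BoseGas.PeriodicTrialState N (Literature.MathematicalPhysics.QuantumManyBody.BoseGas.sideLength ρ N), Literature.MathematicalPhysics.QuantumManyBody.BoseGas.periodicEnergy v Ψ ≤ Literature.MathematicalPhysics.QuantumManyBody.BoseGas.periodicGroundStateEnergy v N (Literature.MathematicalPhysics.QuantumManyBody.BoseGas.sideLength ρ N) + δ → ENNReal.ofReal (c * N) ≤ Literature.MathematicalPhysics.QuantumManyBody.BoseGas.condensateOccupation N (Literature.MathematicalPhysics.QuantumManyBody.BoseGas.sideLength ρ N) Ψ.ψ) → ∃ ρ₀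 : ℝ, 0 < ρ₀ ∧ ∀ ρ : ℝ, 0 < ρ → ρ < ρ₀ → Literature.MathematicalPhysics.QuantumManyBody.BoseGas.HasGroundStateBEC v ρ) → Literature.MathematicalPhysics.QuantumManyBody.BoseGas.BoseEinsteinCondensation

end Summit.AtomisticToContinuum.BoseEinsteinCondensation.Theses.BECJastrowRigidity
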